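import Literature.NumberTheory.Sieve.CFSemigroupRenormalisedTransfer
import HarnessLib

/-!
# Cone stability of the Dolgopyat operators (Magee–Oh–Winter Lemma 24 (1))

Support file (all results proved) for the programme of proving [MageeOhWinter2019, Thm. 4 (2)] (Dolgopyat
bounds) for `Γ_A`, scalar letter-operator form. [MageeOhWinter2019, §4.3]: the cone
`C_{A|b|} = {H ∈ C¹ : H > 0, |H'| ≤ A|b| H}`; the Dolgopyat operators are `N_s^J(H) = L_a^N(χ_J H)` for cut-offs
`χ_J` with `1 - θ ≤ χ_J ≤ 1` ([§4.5]); [Lemma 24 (1)] (= Lemma (core), property (corefirst); Naud Lemma 5.8):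
"the cone `C_{A|b|}` is stable under `N_s^J`", granted `|b| > b₀`, `N > N₀`, `θ` small ([Prop. 28]).

Here we prove the abstract form of this stability for the renormalised positive operator `L̃_a^N` of
`CFSemigroupRenormalisedTransfer.lean` and ANY `C¹` cut-off `χ` with `1 - θ ≤ χ ≤ 1`, `|χ'| ≤ C_χ |b|`:

* `exists_hasDerivWithinAt_cfLRa` — the real a priori bound:
  `|(L̃_a^N g)'| ≤ 6a L̃_a^N|g| + 2(1/2)^N L̃_a^N|g'|` (from the complex Lemma 23 (1) at `b = 0`);
* `cfDolgCone_stable` — **cone stability:** if `H > 0`, `|H'| ≤ A|b|H` on `[0,1]`, and the parameters satisfy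
  `12a ≤ A|b|` and `4(1/2)^N (C_χ + A) ≤ (1-θ)A`, then `N(H) = L̃_a^N(χH) > 0` and `|N(H)'| ≤ A|b| N(H)` on `[0,1]`.

## References

* [MageeOhWinter2019] M. Magee, H. Oh, D. Winter, J. reine angew. Math. 753 (2019) 89–135, §4.3 Lemma 24 (1),
  §4.5 (Dolgopyat operators), Prop. 28 (after F. Naud, Ann. Sci. ÉNS 38 (2005), Lemma 5.8).
-/

noncomputable section

open Set Filter Complex
open scoped Topology

namespace Literature.NumberTheory.Sieve

variable {A : Finset ℕ} (hA : ∀ a ∈ A, 1 ≤ a)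

/-! ### The real a priori bound -/

include hA in
/-- At `b = 0` and for a real `g`, `L̃_s^n (g : ℂ) = (L̃_a^n g : ℂ)` on `[0,1]`. [folklore] -/
theorem cfLRn_zero_ofReal (hne : A.Nonempty) {a : ℝ} (ha : 0 ≤ a) (n : ℕ) (g : ℝ → ℝ) {x : ℝ} (hx : x ∈ Icc (0 : ℝ) 1) :
    cfLRn hA hne ha 0 n (fun y => (g y : ℂ)) x = ((cfLRa hA hne ha n g x : ℝ) : ℂ) := by
  unfold cfLRn cfLRa
  push_cast
  rw [Finset.mul_sum, Finset.mul_sum]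
  refine Finset.sum_congr rfl fun w _ => ?_
  have hw := one_le_coe_digit hA w
  have hd := cfDenom_cfMat_pos hw hx
  have e : ((a : ℂ) + 0 * I) = ((a : ℝ) : ℂ) := by simp
  rw [e, cfWt_ofReal a _ hd, cfRealWt]
  ring

include hA in
/-- **The real a priori bound:** for a real `C¹` function `g` on `[0,1]` (derivative `g'` within `[0,1]`),
`L̃_a^n g` has a derivative `D` within `[0,1]` at each `x ∈ [0,1]` with
`|D| ≤ 6a (L̃_a^n |g|)(x) + 2 (1/2)^n (L̃_a^n |g'|)(x)`. [cite: MageeOhWinter2019, Lemma 23 (1)] -/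
theorem exists_hasDerivWithinAt_cfLRa (hne : A.Nonempty) {a : ℝ} (ha : 0 ≤ a) (n : ℕ) {g g' : ℝ → ℝ}
    (hg : ∀ y ∈ Icc (0 : ℝ) 1, HasDerivWithinAt g (g' y) (Icc (0 : ℝ) 1) y) {x : ℝ} (hx : x ∈ Icc (0 : ℝ) 1) :
    ∃ D : ℝ, HasDerivWithinAt (cfLRa hA hne ha n g) D (Icc (0 : ℝ) 1) x ∧
      |D| ≤ 6 * a * cfLRa hA hne ha n (fun y => |g y|) x + 2 * (1 / 2) ^ n * cfLRa hA hne ha n (fun y => |g' y|) x := by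
  have hgc : ∀ y ∈ Icc (0 : ℝ) 1, HasDerivWithinAt (fun y => (g y : ℂ)) ((g' y : ℝ) : ℂ) (Icc (0 : ℝ) 1) y :=
    fun y hy => (hg y hy).ofReal_comp
  obtain ⟨D, hD, hDle⟩ := exists_hasDerivWithinAt_cfLRn hA hne ha 0 n hgc hx
  -- the complex function is real-valued on `[0,1]`; take real parts
  have hre := (Complex.reCLM.hasFDerivAt (x := cfLRn hA hne ha 0 n (fun y => (g y : ℂ)) x)).hasFDerivWithinAt
    (s := univ) |>.comp_hasDerivWithinAt x hD (mapsTo_univ _ _)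
  have hcongr : ∀ y ∈ Icc (0 : ℝ) 1, (Complex.reCLM ∘ cfLRn hA hne ha 0 n fun y => (g y : ℂ)) y = cfLRa hA hne ha n g y :=
    fun y hy => by simp [Function.comp, cfLRn_zero_ofReal hA hne ha n g hy]
  refine ⟨Complex.reCLM D, hre.congr_of_mem (fun y hy => (hcongr y hy).symm) hx, ?_⟩
  have h1 : |Complex.reCLM D| ≤ ‖D‖ := by simpa using Complex.abs_re_le_norm D
  refine h1.trans (hDle.trans ?_)
  have hs : ‖((a : ℂ) + ((0 : ℝ) : ℂ) * I)‖ = a := by simp [abs_of_nonneg ha]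
  rw [hs]
  have e1 : cfLRa hA hne ha n (fun y => ‖(g y : ℂ)‖) x = cfLRa hA hne ha n (fun y => |g y|) x := by
    simp only [Complex.norm_real, Real.norm_eq_abs]
  have e2 : cfLRa hA hne ha n (fun y => ‖((g' y : ℝ) : ℂ)‖) x = cfLRa hA hne ha n (fun y => |g' y|) x := by
    simp only [Complex.norm_real, Real.norm_eq_abs]
  rw [e1, e2]
  linarith

/-! ### Cone stability -/

include hA in
/-- **Cone stability of the Dolgopyat operators [MageeOhWinter2019, Lemma 24 (1)]** (abstract form). Let
`χ` be `C¹` on `[0,1]` with `1 - θ ≤ χ ≤ 1`, `|χ'| ≤ C_χ|b|` (`θ < 1`), and let `H > 0` be `C¹` on `[0,1]` with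
`|H'| ≤ A|b|H` (the cone `C_{A|b|}`). If `12a ≤ A|b|` and `4 (1/2)^N (C_χ + A) ≤ (1-θ) A` then
`N(H) := L̃_a^N(χ H)` is positive on `[0,1]` and has a derivative `D` within `[0,1]` with `|D| ≤ A|b| N(H)(x)`:
`N(H) ∈ C_{A|b|}`. [cite: MageeOhWinter2019, Lemma 24 (1) and Prop. 28] -/
theorem cfDolgCone_stable (hne : A.Nonempty) {a : ℝ} (ha : 0 ≤ a) (N : ℕ) {Acone b θ Cχ : ℝ}
    (hAcone : 0 ≤ Acone) (hθ1 : θ < 1) (hCχ : 0 ≤ Cχ)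
    (hpar1 : 12 * a ≤ Acone * |b|) (hpar2 : 4 * (1 / 2) ^ N * (Cχ + Acone) ≤ (1 - θ) * Acone)
    {χ χ' : ℝ → ℝ} (hχd : ∀ y ∈ Icc (0 : ℝ) 1, HasDerivWithinAt χ (χ' y) (Icc (0 : ℝ) 1) y)
    (hχ1 : ∀ y ∈ Icc (0 : ℝ) 1, χ y ≤ 1) (hχθ : ∀ y ∈ Icc (0 : ℝ) 1, 1 - θ ≤ χ y)
    (hχ' : ∀ y ∈ Icc (0 : ℝ) 1, |χ' y| ≤ Cχ * |b|)
    {H H' : ℝ → ℝ} (hHd : ∀ y ∈ Icc (0 : ℝ) 1, HasDerivWithinAt H (H' y) (Icc (0 : ℝ) 1) y)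
    (hHpos : ∀ y ∈ Icc (0 : ℝ) 1, 0 < H y) (hHcone : ∀ y ∈ Icc (0 : ℝ) 1, |H' y| ≤ Acone * |b| * H y)
    {x : ℝ} (hx : x ∈ Icc (0 : ℝ) 1) :
    0 < cfLRa hA hne ha N (fun y => χ y * H y) x ∧
      ∃ D : ℝ, HasDerivWithinAt (cfLRa hA hne ha N (fun y => χ y * H y)) D (Icc (0 : ℝ) 1) x ∧
        |D| ≤ Acone * |b| * cfLRa hA hne ha N (fun y => χ y * H y) x := by
  have h1θ : 0 < 1 - θ := by linarith
  -- `χ H > 0`, so `N(H) > 0`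
  have hχH : ∀ y ∈ Icc (0 : ℝ) 1, 0 < χ y * H y := fun y hy => mul_pos (by linarith [hχθ y hy]) (hHpos y hy)
  have hNpos : 0 < cfLRa hA hne ha N (fun y => χ y * H y) x := by
    -- `L̃_a^N` of a function `≥ c > 0`… use monotonicity against the constant `min`? simpler: strict positivity termwise
    have hpos : 0 < cfEig A a ^ N * cfHfun hA hne ha x := mul_pos (pow_pos (cfEig_pos a) N) (cfHfun_pos hA hne ha hx)
    haveI := hne.to_subtype
    unfold cfLRa
    refine mul_pos (inv_pos.2 hpos) (Finset.sum_pos (fun w _ => ?_) Finset.univ_nonempty)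
    have hw := one_le_coe_digit hA w
    have hm := cfMoeb_cfMat_mem hw hx
    exact mul_pos (mul_pos (cfRealWt_pos hA a w hx) (cfHfun_pos hA hne ha hm)) (hχH _ hm)
  refine ⟨hNpos, ?_⟩
  -- derivative of `χ H` and its cone bound
  have hF : ∀ y ∈ Icc (0 : ℝ) 1, HasDerivWithinAt (fun y => χ y * H y) (χ' y * H y + χ y * H' y) (Icc (0 : ℝ) 1) y :=
    fun y hy => (hχd y hy).mul (hHd y hy)
  have hF' : ∀ y ∈ Icc (0 : ℝ) 1, |χ' y * H y + χ y * H' y| ≤ ((Cχ + Acone) * |b| / (1 - θ)) * |χ y * H y| := by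
    intro y hy
    have hHy := hHpos y hy
    have hχy : 1 - θ ≤ χ y := hχθ y hy
    have hχy1 : χ y ≤ 1 := hχ1 y hy
    have hχpos : 0 < χ y := by linarith
    rw [abs_of_pos (hχH y hy)]
    refine (abs_add_le _ _).trans ?_
    rw [abs_mul, abs_mul, abs_of_pos hHy, abs_of_pos hχpos]
    have h1 : |χ' y| * H y ≤ Cχ * |b| * H y := mul_le_mul_of_nonneg_right (hχ' y hy) hHy.le
    have h2 : χ y * |H' y| ≤ 1 * (Acone * |b| * H y) := mul_le_mul hχy1 (hHcone y hy) (abs_nonneg _) zero_le_one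
    -- `(Cχ + A)|b| H ≤ ((Cχ + A)|b|/(1-θ)) χ H` since `χ ≥ 1 - θ`
    have h3 : (Cχ + Acone) * |b| * H y ≤ (Cχ + Acone) * |b| / (1 - θ) * (χ y * H y) := by
      rw [div_mul_eq_mul_div, le_div_iff₀ h1θ]
      have : 0 ≤ (Cχ + Acone) * |b| * H y := by positivity
      nlinarith
    linarith
  -- the a priori bound for `g = χ H`
  obtain ⟨D, hD, hDle⟩ := exists_hasDerivWithinAt_cfLRa hA hne ha N hF hx
  refine ⟨D, hD, hDle.trans ?_⟩
  have hL1 : cfLRa hA hne ha N (fun y => |χ y * H y|) x = cfLRa hA hne ha N (fun y => χ y * H y) x := by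
    unfold cfLRa
    congr 1
    refine Finset.sum_congr rfl fun w _ => ?_
    simp only [abs_of_pos (hχH _ (cfMoeb_cfMat_mem (one_le_coe_digit hA w) hx))]
  have hL2 : cfLRa hA hne ha N (fun y => |χ' y * H y + χ y * H' y|) x ≤
      ((Cχ + Acone) * |b| / (1 - θ)) * cfLRa hA hne ha N (fun y => χ y * H y) x := by
    rw [← hL1, ← cfLRa_const_mul]
    exact cfLRa_mono hA hne ha (fun y hy => hF' y hy) hx N
  rw [hL1]
  set P := cfLRa hA hne ha N (fun y => χ y * H y) x with hP
  have hP0 : 0 ≤ P := hNpos.le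
  have hpow0 : 0 ≤ (1 / 2 : ℝ) ^ N := pow_nonneg (by norm_num) N
  -- `6a P + 2(1/2)^N ((Cχ+A)|b|/(1-θ)) P ≤ A|b| P`
  have hc1 : 6 * a ≤ Acone * |b| / 2 := by linarith
  have hc2 : 2 * (1 / 2) ^ N * ((Cχ + Acone) * |b| / (1 - θ)) ≤ Acone * |b| / 2 := by
    rw [show 2 * (1 / 2 : ℝ) ^ N * ((Cχ + Acone) * |b| / (1 - θ)) = (2 * (1 / 2) ^ N * (Cχ + Acone) / (1 - θ)) * |b| by ring]
    have h1 : 2 * (1 / 2 : ℝ) ^ N * (Cχ + Acone) / (1 - θ) ≤ Acone / 2 := by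
      rw [div_le_iff₀ h1θ]; linarith
    have := mul_le_mul_of_nonneg_right h1 (abs_nonneg b)
    linarith
  calc 6 * a * P + 2 * (1 / 2) ^ N * cfLRa hA hne ha N (fun y => |χ' y * H y + χ y * H' y|) x
      ≤ 6 * a * P + 2 * (1 / 2) ^ N * (((Cχ + Acone) * |b| / (1 - θ)) * P) := by gcongr
    _ ≤ Acone * |b| / 2 * P + Acone * |b| / 2 * P := by
        have h1 := mul_le_mul_of_nonneg_right hc1 hP0
        have h2 := mul_le_mul_of_nonneg_right hc2 hP0
        nlinarith
    _ = Acone * |b| * P := by ring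

end Literature.NumberTheory.Sieve
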